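import Literature.AnabelianGeometry.SemiGraphs.CharacteristicOpenCore
import Literature.AnabelianGeometry.SemiGraphs.TemperedAnabelian
import Literature.AnabelianGeometry.SemiGraphs.TemperedCurves
import Literature.AnabelianGeometry.AbsoluteAnabelian.MLFGaloisTFGProofs
import Mathlib.Topology.Algebra.OpenSubgroup
import Mathlib.Topology.Separation.Profinite
import HarnessLib

/-!
# Characteristic open cores are EXHAUSTIVE in a profinite group; the `M`-tower of [SemiAnbd] Example 5.6
# at a topologically finitely generated profinite group

Mochizuki, *Semi-graphs of anabelioids*, Publ. RIMS **42** (2006), §5, Example 5.6 p. 67: "an exhaustive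
sequence of open characteristic subgroups `… ⊆ M_i ⊆ … ⊆ Π^tp_X` of finite index"
[cite: MochizukiSemiAnbd2006, Ex 5.6, p. 67]; the group theory is Dixon–du Sautoy–Mann–Segal, *Analytic
pro-`p` groups*, Prop. 1.6 [cite: DixonEtAl1999, Prop 1.6] (finitely many open subgroups of each index in
a topologically finitely generated profinite group, so the intersections over bounded index are open
characteristic subgroups forming a neighbourhood basis of `1`).

PROOF-ONLY companion of abc-iut-w4-d053's `CharacteristicOpenCore.lean` (never edited; abc-iut cell, layer L3,
NV lane, seat abc-iut-w6-d108; theorems only — no `def`, no `instance`, no new named fact).  That file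
proves, for `charOpenCore Γ d := ⋂ {open U ≤ Γ of index ≤ d}`: antitone, fixed by every bi-continuous
automorphism, normal, and — for topologically finitely generated `Γ` — open of finite index and cofinal
among the open finite-index subgroups.  It does NOT record EXHAUSTIVENESS `⨅_d charOpenCore Γ d = ⊥`, the
remaining clause of Example 5.6's "exhaustive sequence of open characteristic subgroups of finite index"
(field `exhaustive_M` of abc-iut-L3-t3's `StableReductionTower`).  Proved here:

* `iInf_charOpenCore_eq_bot_of_separating` — if the open finite-index subgroups of `Γ` separate points
  from `1`, the cores are exhaustive (pure order theory over `charOpenCore_le_of_finiteIndex`);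
* `iInf_charOpenCore_eq_bot` — hence in every PROFINITE group (compact, Hausdorff, totally disconnected:
  a clopen neighbourhood of `1` missing `x ≠ 1` contains an open subgroup, Mathlib's
  `IsTopologicalGroup.exist_openSubgroup_sub_clopen_nhds_of_one`, of finite index by compactness);
* `charOpenCore_isMTower_of_tfg` — for a topologically finitely generated profinite `Γ` the sequence
  `i ↦ charOpenCore Γ i` satisfies ALL FIVE `M`-clauses of `StableReductionTower` verbatim (`isOpen_M`,
  `finiteIndex_M`, `characteristic_M` over `Γ ≃ₜ* Γ`, `antitone_M`, `exhaustive_M`); the TEMPERED shape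
  `charOpenCore_isMTower_of_tfg_of_injective` (t.f.g. `Γ` injecting continuously into a profinite group,
  as `Π^tp_X ↪ Π̂_X`) via `iInf_charOpenCore_eq_bot_of_injective`;
* `TemperedCurve.charOpenCore_isMTower_of_tfg` / `OncePuncturedTemperedGroup.charOpenCore_isMTower_of_tfg` —
  the two tempered interfaces of the layer (`Π^temp ↪ Π̂` injective into the profinite completion), given
  topological finite generation of the tempered group;
* `charOpenCore_isMTower_absoluteGaloisGroup_of_tfg` / `_of_localEPC` — the instance `Γ := G_K`, `K/ℚ_p`
  finite, with Def 5.1 (i)(a) "`G_K` topologically finitely generated" explicit resp. modulo the tree's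
  named fact `localEulerPoincareCharacteristic` (abc-iut-L4-d1's carrying; unconditional Summits-side via
  p421667).

HONEST LABEL: group theory only; the `M`-tower of Example 5.6 lives in the TEMPERED group `Π^tp_X` (not
compact), for which exhaustiveness is the residually-profinite form (`…_of_injective`); the remaining input
there is the topological finite generation of `Π^tp_X` itself.  Nothing of [SemiAnbd] about curves is asserted; no side is taken on [IUTchIII]
Cor. 3.12.
-/

noncomputable section

namespace Literature.AnabelianGeometry.SemiGraphs

open _root_.Topology
open Literature.AnabelianGeometry.AbsoluteAnabelian
open Literature.NumberTheory.GaloisRepresentations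

universe u

section Exhaustive

variable {Γ : Type u} [Group Γ] [TopologicalSpace Γ]

/-- **Exhaustiveness from point separation.**  If every `x ≠ 1` lies outside some open subgroup of finite
index, then `⨅_d charOpenCore Γ d = ⊥` (the core of level `[Γ : U]` lies in `U`).
[cite: DixonEtAl1999, Prop 1.6] -/
theorem iInf_charOpenCore_eq_bot_of_separating
    (hsep : ∀ x : Γ, x ≠ 1 → ∃ U : Subgroup Γ, IsOpen (U : Set Γ) ∧ U.FiniteIndex ∧ x ∉ U) :
    ⨅ d, charOpenCore Γ d = ⊥ := by
  rw [eq_bot_iff]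
  intro x hx
  rw [Subgroup.mem_bot]
  by_contra hne
  obtain ⟨U, hUo, hUfi, hxU⟩ := hsep x hne
  exact hxU (charOpenCore_le_of_finiteIndex U hUo (Subgroup.mem_iInf.mp hx U.index))

/-- In a compact Hausdorff totally disconnected group the open subgroups of finite index separate points
from `1`: a clopen set containing `1` and missing `x` (total separatedness) contains an open subgroup
(`IsTopologicalGroup.exist_openSubgroup_sub_clopen_nhds_of_one`), of finite index by compactness.
[cite: DixonEtAl1999, Prop 1.6] -/
theorem exists_openSubgroup_finiteIndex_not_mem [IsTopologicalGroup Γ] [CompactSpace Γ] [T2Space Γ]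
    [TotallyDisconnectedSpace Γ] (x : Γ) (hx : x ≠ 1) :
    ∃ U : Subgroup Γ, IsOpen (U : Set Γ) ∧ U.FiniteIndex ∧ x ∉ U := by
  obtain ⟨W, hW, h1W, hxW⟩ := exists_isClopen_of_totally_separated (α := Γ) (Ne.symm hx)
  obtain ⟨H, hH⟩ := IsTopologicalGroup.exist_openSubgroup_sub_clopen_nhds_of_one hW h1W
  haveI : H.toSubgroup.FiniteIndex := H.finiteIndex_of_finite_quotient
  exact ⟨H, H.isOpen, inferInstance, fun hxH => hxW (hH hxH)⟩

/-- **The characteristic open cores of a PROFINITE group are exhaustive**: `⨅_d charOpenCore Γ d = ⊥`.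
[cite: DixonEtAl1999, Prop 1.6] -/
theorem iInf_charOpenCore_eq_bot [IsTopologicalGroup Γ] [CompactSpace Γ] [T2Space Γ]
    [TotallyDisconnectedSpace Γ] : ⨅ d, charOpenCore Γ d = ⊥ :=
  iInf_charOpenCore_eq_bot_of_separating exists_openSubgroup_finiteIndex_not_mem

/-- Characteristic open cores are fixed by every isomorphism of topological groups `Γ ≃ₜ* Γ` (the binder
shape `characteristic_M` of `StableReductionTower`; `map_charOpenCore_eq` repackaged).
[cite: DixonEtAl1999, Prop 1.6] -/
theorem map_continuousMulEquiv_charOpenCore (d : ℕ) (φ : Γ ≃ₜ* Γ) :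
    (charOpenCore Γ d).map φ.toMonoidHom = charOpenCore Γ d :=
  map_charOpenCore_eq φ.toMulEquiv φ.continuous φ.symm.continuous

/-- **The `M`-tower of [SemiAnbd] Example 5.6 at a topologically finitely generated PROFINITE group**:
`i ↦ charOpenCore Γ i` is a sequence of OPEN, FINITE-INDEX subgroups, each fixed by every `Γ ≃ₜ* Γ`
(CHARACTERISTIC), ANTITONE and EXHAUSTIVE — the five `M`-clauses of `StableReductionTower` verbatim.
[cite: MochizukiSemiAnbd2006, Ex 5.6, p. 67] -/
theorem charOpenCore_isMTower_of_tfg [IsTopologicalGroup Γ] [CompactSpace Γ] [T2Space Γ]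
    [TotallyDisconnectedSpace Γ] (hG : IsTopologicallyFinitelyGenerated Γ) :
    (∀ i, IsOpen (charOpenCore Γ i : Set Γ)) ∧ (∀ i, (charOpenCore Γ i).FiniteIndex) ∧
      (∀ (i : ℕ) (φ : Γ ≃ₜ* Γ), (charOpenCore Γ i).map φ.toMonoidHom = charOpenCore Γ i) ∧
      Antitone (charOpenCore Γ) ∧ ⨅ i, charOpenCore Γ i = ⊥ :=
  ⟨isOpen_charOpenCore_of_tfg hG, finiteIndex_charOpenCore_of_tfg hG, map_continuousMulEquiv_charOpenCore,
    fun _ _ h => charOpenCore_anti h, iInf_charOpenCore_eq_bot⟩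

/-! #### The tempered shape: residually profinite groups -/

/-- If `Γ` injects continuously into a profinite group (e.g. a tempered group into its profinite
completion, [SemiAnbd] §6 "natural injection `Π^temp_{X_K} ↪ Π_{X_K}`"), its open finite-index subgroups
separate points from `1` (pull back a separating open subgroup of the profinite group).
[cite: MochizukiSemiAnbd2006, §6 p.69] -/
theorem exists_openSubgroup_finiteIndex_not_mem_of_injective [IsTopologicalGroup Γ] {P : Type*} [Group P]
    [TopologicalSpace P] [IsTopologicalGroup P] [CompactSpace P] [T2Space P] [TotallyDisconnectedSpace P]
    (ι : Γ →ₜ* P) (hι : Function.Injective ι) (x : Γ) (hx : x ≠ 1) :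
    ∃ U : Subgroup Γ, IsOpen (U : Set Γ) ∧ U.FiniteIndex ∧ x ∉ U := by
  have hx' : ι x ≠ 1 := fun h => hx (hι (by rw [h, map_one]))
  obtain ⟨V, hVo, hVfi, hxV⟩ := exists_openSubgroup_finiteIndex_not_mem (ι x) hx'
  haveI := hVfi
  refine ⟨V.comap ι.toMonoidHom, hVo.preimage ι.continuous, ⟨?_⟩, fun h => hxV (Subgroup.mem_comap.mp h)⟩
  rw [Subgroup.index_comap]
  exact Subgroup.FiniteIndex.index_ne_zero

/-- **Exhaustiveness for residually profinite groups** (the tempered case): if `Γ` injects continuously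
into a profinite group then `⨅_d charOpenCore Γ d = ⊥`. [cite: MochizukiSemiAnbd2006, Ex 5.6, p. 67] -/
theorem iInf_charOpenCore_eq_bot_of_injective [IsTopologicalGroup Γ] {P : Type*} [Group P]
    [TopologicalSpace P] [IsTopologicalGroup P] [CompactSpace P] [T2Space P] [TotallyDisconnectedSpace P]
    (ι : Γ →ₜ* P) (hι : Function.Injective ι) : ⨅ d, charOpenCore Γ d = ⊥ :=
  iInf_charOpenCore_eq_bot_of_separating (exists_openSubgroup_finiteIndex_not_mem_of_injective ι hι)

/-- **The `M`-tower at a topologically finitely generated group injecting continuously into a profinite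
group** (the TEMPERED shape of Example 5.6: `Π^tp_X ↪ Π̂_X`): the five `M`-clauses of `StableReductionTower`
for `i ↦ charOpenCore Γ i`. [cite: MochizukiSemiAnbd2006, Ex 5.6, p. 67] -/
theorem charOpenCore_isMTower_of_tfg_of_injective [IsTopologicalGroup Γ]
    (hG : IsTopologicallyFinitelyGenerated Γ) {P : Type*} [Group P] [TopologicalSpace P]
    [IsTopologicalGroup P] [CompactSpace P] [T2Space P] [TotallyDisconnectedSpace P]
    (ι : Γ →ₜ* P) (hι : Function.Injective ι) :
    (∀ i, IsOpen (charOpenCore Γ i : Set Γ)) ∧ (∀ i, (charOpenCore Γ i).FiniteIndex) ∧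
      (∀ (i : ℕ) (φ : Γ ≃ₜ* Γ), (charOpenCore Γ i).map φ.toMonoidHom = charOpenCore Γ i) ∧
      Antitone (charOpenCore Γ) ∧ ⨅ i, charOpenCore Γ i = ⊥ :=
  ⟨isOpen_charOpenCore_of_tfg hG, finiteIndex_charOpenCore_of_tfg hG, map_continuousMulEquiv_charOpenCore,
    fun _ _ h => charOpenCore_anti h, iInf_charOpenCore_eq_bot_of_injective ι hι⟩

end Exhaustive

/-! ### The tempered interfaces of the layer: `Π^temp_{X_K} ↪ Π_{X_K}` ([SemiAnbd] §6, Example 3.10) -/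

section Tempered

/-- **The `M`-tower in `Π^temp_{X_K}`** for the §6 interface `TemperedCurve p` ("natural injection
`Π^temp_{X_K} ↪ Π_{X_K}`" into the profinite completion, p. 69), GIVEN the topological finite generation of
`Π^temp_{X_K}`: the characteristic open cores of `Π^temp_{X_K}` satisfy the five `M`-clauses of
`StableReductionTower`. [cite: MochizukiSemiAnbd2006, §6 p.69] -/
theorem TemperedCurve.charOpenCore_isMTower_of_tfg {p : ℕ} [Fact p.Prime] (X : TemperedCurve p)
    (hG : IsTopologicallyFinitelyGenerated X.PiTemp) :
    (∀ i, IsOpen (charOpenCore X.PiTemp i : Set X.PiTemp)) ∧ (∀ i, (charOpenCore X.PiTemp i).FiniteIndex) ∧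
      (∀ (i : ℕ) (φ : X.PiTemp ≃ₜ* X.PiTemp),
        (charOpenCore X.PiTemp i).map φ.toMonoidHom = charOpenCore X.PiTemp i) ∧
      Antitone (charOpenCore X.PiTemp) ∧ ⨅ i, charOpenCore X.PiTemp i = ⊥ := by
  haveI := X.isProfiniteCompletion_toHat.compactSpace
  haveI := X.isProfiniteCompletion_toHat.t2Space
  haveI := X.isProfiniteCompletion_toHat.totallyDisconnectedSpace
  exact charOpenCore_isMTower_of_tfg_of_injective hG X.toHat X.toHat_injective

/-- **The `M`-tower in `Π^tp_X`** for the Example 3.10 interface `OncePuncturedTemperedGroup K` (with its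
profinite completion `Π^tp_X ↪ Π_X`), GIVEN the topological finite generation of `Π^tp_X`: the five
`M`-clauses of `StableReductionTower 𝓥 D.toTemperedArithmeticGroup` hold for `M_i := charOpenCore Π^tp_X i`
— what remains for a tower at such a `D` is the LEVEL data (`𝔊_i`, admissible kernels, decomposition data).
[cite: MochizukiSemiAnbd2006, Ex 5.6, p. 67] -/
theorem OncePuncturedTemperedGroup.charOpenCore_isMTower_of_tfg {K : Type u} [Field K]
    (D : OncePuncturedTemperedGroup K) (hG : IsTopologicallyFinitelyGenerated D.Pi) :
    (∀ i, IsOpen (charOpenCore D.Pi i : Set D.Pi)) ∧ (∀ i, (charOpenCore D.Pi i).FiniteIndex) ∧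
      (∀ (i : ℕ) (φ : D.Pi ≃ₜ* D.Pi), (charOpenCore D.Pi i).map φ.toMonoidHom = charOpenCore D.Pi i) ∧
      Antitone (charOpenCore D.Pi) ∧ ⨅ i, charOpenCore D.Pi i = ⊥ := by
  haveI := D.isProfiniteCompletion_toHat.compactSpace
  haveI := D.isProfiniteCompletion_toHat.t2Space
  haveI := D.isProfiniteCompletion_toHat.totallyDisconnectedSpace
  exact charOpenCore_isMTower_of_tfg_of_injective hG D.toHat D.toHat_injective

end Tempered

/-! ### The instance `Γ := G_K`, `K/ℚ_p` finite -/

section Galois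

open Field

/-- **The `M`-tower at `G_K`** (`K` a finite extension of `ℚ_p`), GIVEN Def 5.1 (i)(a) "`G_K` topologically
finitely generated" as an explicit hypothesis (dischargeable Summits-side by
`Summit.ABC.IUTFork.isTopologicallyFinitelyGenerated_absoluteGaloisGroup_padic`, p421667): the characteristic
open cores of `G_K` are open, of finite index, characteristic, antitone and exhaustive.
[cite: MochizukiSemiAnbd2006, Ex 5.6, p. 67] -/
theorem charOpenCore_isMTower_absoluteGaloisGroup_of_tfg (K : Type) [Field K] [CharZero K]
    (hA : IsTopologicallyFinitelyGenerated (absoluteGaloisGroup K)) :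
    (∀ i, IsOpen (charOpenCore (absoluteGaloisGroup K) i : Set (absoluteGaloisGroup K))) ∧
      (∀ i, (charOpenCore (absoluteGaloisGroup K) i).FiniteIndex) ∧
      (∀ (i : ℕ) (φ : absoluteGaloisGroup K ≃ₜ* absoluteGaloisGroup K),
        (charOpenCore (absoluteGaloisGroup K) i).map φ.toMonoidHom = charOpenCore (absoluteGaloisGroup K) i) ∧
      Antitone (charOpenCore (absoluteGaloisGroup K)) ∧ ⨅ i, charOpenCore (absoluteGaloisGroup K) i = ⊥ :=
  charOpenCore_isMTower_of_tfg hA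

/-- **The `M`-tower at `G_K`, `K/ℚ_p` finite, modulo Tate's local Euler–Poincaré characteristic BY NAME**
(the tree's named fact `localEulerPoincareCharacteristic`, carried exactly as in abc-iut-L4-d1's
`isTopologicallyFinitelyGenerated_absoluteGaloisGroup_padic_of_localEPC`).
[cite: MochizukiSemiAnbd2006, Ex 5.6, p. 67] [cite: NeukirchSchmidtWingberg2008, Thm. 7.5.10] -/
theorem charOpenCore_isMTower_absoluteGaloisGroup_of_localEPC
    (hEP : ∀ (F : Type) [Field F] [ValuativeRel F] [TopologicalSpace F] [IsNonarchimedeanLocalField F]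
      [CharZero F], localEulerPoincareCharacteristic F)
    (p : ℕ) [Fact p.Prime] (K : Type) [Field K] [Algebra ℚ_[p] K] [FiniteDimensional ℚ_[p] K] [CharZero K] :
    (∀ i, IsOpen (charOpenCore (absoluteGaloisGroup K) i : Set (absoluteGaloisGroup K))) ∧
      (∀ i, (charOpenCore (absoluteGaloisGroup K) i).FiniteIndex) ∧
      (∀ (i : ℕ) (φ : absoluteGaloisGroup K ≃ₜ* absoluteGaloisGroup K),
        (charOpenCore (absoluteGaloisGroup K) i).map φ.toMonoidHom = charOpenCore (absoluteGaloisGroup K) i) ∧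
      Antitone (charOpenCore (absoluteGaloisGroup K)) ∧ ⨅ i, charOpenCore (absoluteGaloisGroup K) i = ⊥ :=
  charOpenCore_isMTower_absoluteGaloisGroup_of_tfg K
    (isTopologicallyFinitelyGenerated_absoluteGaloisGroup_padic_of_localEPC hEP p K)

end Galois

end Literature.AnabelianGeometry.SemiGraphs

end
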